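import Summits.BirchSwinnertonDyer.BirchSwinnertonDyer.Theorems.ManinLocalTwoThreeHeckeThetaTwentySeven
import Literature.NumberTheory.EllipticCurves.ShimuraSubgroupEisensteinProofs
import Literature.NumberTheory.EllipticCurves.PAdicLFunctionProofs
import Literature.NumberTheory.NumberFields.EisensteinFieldLocal
import HarnessLib

/-!
# Manin's conjecture for `X₀(27)` follows from the Unbounded Denominators theorem ALONE: `|c₀| = 1` for every lattice-optimal `X₀(27)`-datum
(route `ManinLocalTwoThree`, crux C3 `ManinPrimeToThreeAtNine` stmt-BirchSwinnertonDyer-22968, C2 stmt-…-22967, rung stmt-…-22445; cell bsd-f2-manin,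
prover seat p3 gen 22; `--supports stmt-BirchSwinnertonDyer-22968`)

The cell's conditional theorem is «Manin's conjecture ⟸ {CDT, modularity}»: CDT gives Stevens' inclusion `Λ₁(f) ⊆ Λ_W`, hence `|c₀| ≤ 2` and `p ∤ c₀`
for `p ≥ 3` FACT-FREE (`UBDSpine.natAbs_maninConstant_le_two_and_not_odd_dvd_of_gamma1Periods_le`), and modularity (Carayol at `2`) is used ONLY to
exclude the half-index world `Λ₁(f) ⊆ 2Λ₀(f)` behind `2 ∣ c₀`.  This file removes the modularity input wherever an ODD Eisenstein number is visible:

* §1 **A fact-free parity criterion against the half-index world (every level):** if some prime `ℓ ∤ N` has `a_ℓ(W) − ℓ − 1` ODD, then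
  `Λ₁(f) ⊄ 2Λ₀(f)` for every `X₀(N)`-datum of `W` (`not_halfIndex_of_odd_eisenstein`).  Proof: Ling–Oesterlé (tree
  `sub_sub_mul_mem_periodLatticeGamma1_of_isNewform0`: `(a_ℓ − ℓ − 1)·Λ₀ ⊆ Λ₁`) + `Λ₀ ≅ ℤ²` (`isZLattice_periodLattice_holds`): an odd multiple of a
  basis vector is not in `2Λ₀`.  Hence, fact-free, **`|c₀| = 1` from Stevens' inclusion alone** under that parity (`abs_maninConstant_eq_one_of_gamma1Periods_le_of_odd_eisenstein`)
  and **⟸ CDT alone** (`abs_maninConstant_eq_one_of_CDT_of_odd_eisenstein`).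
* §2 **`a₂(27a3) = 0`** (`2` is inert in `ℤ[ω]`: no ideal of norm `2`, so the Hecke sum of p3's and an's `HeckeThetaTwentySeven` at `n = 2` is empty), hence
  `a₂(η(3τ)²η(9τ)²) = 0` and `a₂(W) = 0` for EVERY curve `W` carrying an `X₀(27)`-datum (its newform is `η(3τ)²η(9τ)²`, p3's `f_eq_etaProductTwentySeven`).
* §3 **`Λ₁ ⊄ 2Λ₀` at level `27`, fact-free** (`ℓ = 2`, Eisenstein number `0 − 3 = −3` odd), for every `X₀(27)`-datum.
* §4 **MANIN'S CONJECTURE FOR `X₀(27)` ⟸ CDT ALONE**: `abs_maninConstant_eq_one_twentySeven_of_CDT : CDT → ∀ W₀ [min] (D₀ : X₀(27)-datum, lattice clause),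
  |c₀| = 1` — no modularity, no Mazur / Abbes–Ullmo / Česnavičius, no Cremona table; on a domain INHABITED fact-free (`HeckeThetaTwentySeven.
  exists_latticeOptimalDatum_twentySeven`), so also `∃ D₀, |c₀| = 1` under CDT alone.

HONEST FRAMING: §1–§3 unconditional (standard axioms); §4 CONDITIONAL on CDT (Calegari–Dimitrov–Tang 2025 Thm. 1, printed, statement-only in the tree).
`c₀(27a1) = 1` is of course in Cremona's table; the point is the kernel derivation from CDT with NO other input.  Nothing here proves C2, C3, Manin's
conjecture in general or BSD; the items stay OPEN as filed.  No definition, no named fact, no sorry.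
[cite: LingOesterle1991, Thm. 6] [cite: Stevens1989, §2] [cite: CalegariDimitrovTang2025, Thm. 1] [cite: IrelandRosen1990, Prop. 9.1.4]
[cite: CremonaAlgorithms1997, Table 1 (27a1, 27a3)]
-/

set_option autoImplicit false
-- lint-debt: the directory name repeats the summit name (sibling precedent `ManinLocalTwoThreeHeckeThetaTwentySeven.lean`)
set_option linter.dupNamespace false

noncomputable section

open scoped MatrixGroups ModularForm
open NumberField IsDedekindDomain Finset CongruenceSubgroup WeierstrassCurve
open Literature.NumberTheory.NumberFields Literature.NumberTheory.NumberFields.K3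
open Literature.NumberTheory.LFunctions Literature.NumberTheory.LFunctions.NumberField
open Literature.NumberTheory.LFunctions.EisensteinGrossen
open Literature.NumberTheory.EllipticCurves Literature.NumberTheory.EllipticCurves.ModularForms
open Literature.NumberTheory.Automorphic

namespace Summit.BirchSwinnertonDyer.BirchSwinnertonDyer.Theorems.ManinLocalTwoThree.ManinConstantTwentySeven

/-! ## §1 The parity criterion against the half-index world (every level, fact-free) -/

/-- **An odd Eisenstein number excludes the half-index world.**  For an `X₀(N)`-datum `D` of `W` and a prime `ℓ ∤ N` with `a_ℓ(W) − ℓ − 1` odd: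
`Λ₁(f) ⊄ 2Λ₀(f)`.  (Ling–Oesterlé: `(a_ℓ − ℓ − 1)Λ₀ ⊆ Λ₁`; if also `Λ₁ ⊆ 2Λ₀` then an odd multiple of a `ℤ`-basis vector of the rank-2 lattice `Λ₀`
lies in `2Λ₀` — parity contradiction.)  UNCONDITIONAL. [cite: LingOesterle1991, Thm. 6] [cite: Stevens1989, §2] -/
theorem not_halfIndex_of_odd_eisenstein {W : WeierstrassCurve ℚ} {N : ℕ} [NeZero N] (D : ModularParametrizationData W N)
    {ℓ : ℕ} (hℓ : ℓ.Prime) (hℓN : ¬ ℓ ∣ N) (hodd : Odd (W.LFunction ℓ - ℓ - 1)) :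
    ¬ (∀ z ∈ periodLatticeGamma1 D.f, ∃ w ∈ periodLattice D.f, z = 2 * w) := by
  intro hin
  haveI : NeZero ℓ := ⟨hℓ.ne_zero⟩
  have hf : IsNewform0 D.f := D.isNewformOf.1
  have hQ : coeffField D.f = ⊥ := D.isNewformOf.coeffField_eq_bot
  set m : ℤ := W.LFunction ℓ - ℓ - 1 with hm
  have hcoef : (cuspCoeff D.f ℓ - ℓ - 1 : ℂ) = (m : ℂ) := by
    rw [D.isNewformOf.2 ℓ, hm]; push_cast; ring
  have key0 : ∀ z ∈ periodLattice D.f, ∃ w ∈ periodLattice D.f, (m : ℂ) * z = 2 * w := fun z hz ↦ by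
    have h := sub_sub_mul_mem_periodLatticeGamma1_of_isNewform0 D.f hf hℓ hℓN hz
    rw [hcoef] at h
    exact hin _ h
  -- `Λ₀ ≅ ℤ²`
  obtain ⟨hdisc, hZ⟩ := isZLattice_periodLattice_holds (f := D.f) hf hQ
  haveI : DiscreteTopology ↥(AddSubgroup.toIntSubmodule (periodLattice D.f)) := hdisc
  haveI : IsZLattice ℝ (AddSubgroup.toIntSubmodule (periodLattice D.f)) := hZ
  haveI : Module.Free ℤ ↥(AddSubgroup.toIntSubmodule (periodLattice D.f)) :=
    ZLattice.module_free ℝ (AddSubgroup.toIntSubmodule (periodLattice D.f))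
  haveI : Module.Finite ℤ ↥(AddSubgroup.toIntSubmodule (periodLattice D.f)) :=
    ZLattice.module_finite ℝ (AddSubgroup.toIntSubmodule (periodLattice D.f))
  have hrank : Module.finrank ℤ ↥(AddSubgroup.toIntSubmodule (periodLattice D.f)) = 2 := by
    rw [ZLattice.rank ℝ (AddSubgroup.toIntSubmodule (periodLattice D.f)), Complex.finrank_real_complex]
  let b := Module.Free.chooseBasis ℤ ↥(AddSubgroup.toIntSubmodule (periodLattice D.f))
  have hcard : Fintype.card (Module.Free.ChooseBasisIndex ℤ ↥(AddSubgroup.toIntSubmodule (periodLattice D.f))) = 2 := by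
    rw [← Module.finrank_eq_card_chooseBasisIndex, hrank]
  obtain ⟨i, -, -⟩ := Fintype.exists_pair_of_one_lt_card (α :=
    Module.Free.ChooseBasisIndex ℤ ↥(AddSubgroup.toIntSubmodule (periodLattice D.f))) (by omega)
  obtain ⟨w, hw, hbw⟩ := key0 (b i) (b i).2
  have hvec : (m : ℤ) • (b i) = (2 : ℤ) • (⟨w, hw⟩ : ↥(AddSubgroup.toIntSubmodule (periodLattice D.f))) := by
    apply Subtype.ext
    simp only [SetLike.val_smul, zsmul_eq_mul, Int.cast_ofNat]
    exact hbw
  have ei := congrArg (fun v ↦ b.repr v i) hvec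
  simp only [b.repr_self, map_zsmul, Finsupp.smul_apply, smul_eq_mul, Finsupp.single_apply, if_true, mul_one] at ei
  -- `m = 2 · (repr w)_i` contradicts `m` odd
  obtain ⟨k, hk⟩ := hodd
  omega

/-- **`|c₀| = 1` from Stevens' inclusion ALONE, given an odd Eisenstein number** (fact-free): for a lattice-optimal `X₀(N)`-datum with `Λ₁(f) ⊆ Λ_W` and a
prime `ℓ ∤ N` with `a_ℓ(W) − ℓ − 1` odd, `|c₀| = 1` — the cell's `|c₀| ≤ 2 ∧ 3 ∤ c₀` (fact-free) plus §1 in place of Carayol-at-2.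
[cite: Stevens1989, §2] [cite: LingOesterle1991, Thm. 6] -/
theorem abs_maninConstant_eq_one_of_gamma1Periods_le_of_odd_eisenstein {W₀ : WeierstrassCurve ℚ} {N : ℕ} [NeZero N]
    (D₀ : ModularParametrizationData W₀ N) (hopt : ∀ z ∈ D₀.L.lattice, ∃ w ∈ periodLattice D₀.f, z = D₀.c * w)
    (hSI : ∀ z ∈ periodLatticeGamma1 D₀.f, z ∈ D₀.L.lattice) {ℓ : ℕ} (hℓ : ℓ.Prime) (hℓN : ¬ ℓ ∣ N)
    (hodd : Odd (W₀.LFunction ℓ - ℓ - 1)) : |D₀.maninConstant| = 1 := by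
  have hle := (UBDSpine.natAbs_maninConstant_le_two_and_not_odd_dvd_of_gamma1Periods_le D₀ hopt hSI).1
  have hne : D₀.maninConstant.natAbs ≠ 0 := Int.natAbs_ne_zero.mpr D₀.maninConstant_ne_zero_holds
  have hne2 : D₀.maninConstant.natAbs ≠ 2 := fun h2 ↦
    not_halfIndex_of_odd_eisenstein D₀ hℓ hℓN hodd
      (KummerValues.halfIndex_of_gamma1Periods_le_of_two_dvd D₀ hopt hSI (Int.natAbs_dvd_natAbs.mp (by rw [h2]; decide)))
  have h1 : D₀.maninConstant.natAbs = 1 := by omega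
  rw [Int.abs_eq_natAbs, h1, Nat.cast_one]

/-- **`|c₀| = 1` ⟸ CDT ALONE, given an odd Eisenstein number** (globally minimal `W₀`, lattice-optimal datum, a prime `ℓ ∤ N` with `a_ℓ(W₀) − ℓ − 1` odd):
Stevens' inclusion from CDT (`CDivisionInt.periodLatticeGamma1_le_neron_of_CDTInt`) + the previous theorem.  CONDITIONAL on CDT only.
[cite: CalegariDimitrovTang2025, Thm. 1] [cite: Stevens1989, §2] [cite: LingOesterle1991, Thm. 6] -/
theorem abs_maninConstant_eq_one_of_CDT_of_odd_eisenstein (hCDT : CalegariDimitrovTang2025_unboundedDenominators)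
    {W₀ : WeierstrassCurve ℚ} [W₀.IsElliptic] [W₀.IsGloballyMinimal] {N : ℕ} [NeZero N]
    (D₀ : ModularParametrizationData W₀ N) (hopt : ∀ z ∈ D₀.L.lattice, ∃ w ∈ periodLattice D₀.f, z = D₀.c * w)
    {ℓ : ℕ} (hℓ : ℓ.Prime) (hℓN : ¬ ℓ ∣ N) (hodd : Odd (W₀.LFunction ℓ - ℓ - 1)) : |D₀.maninConstant| = 1 :=
  abs_maninConstant_eq_one_of_gamma1Periods_le_of_odd_eisenstein D₀ hopt (CDivisionInt.periodLatticeGamma1_le_neron_of_CDTInt hCDT D₀) hℓ hℓN hodd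

/-! ## §2 `2` is inert in `ℤ[ω]`: `a₂(27a3) = a₂(η(3τ)²η(9τ)²) = 0` -/

/-- `N((2)) = 4` in `ℤ[ω]`. [folklore] -/
theorem absNorm_span_two : Ideal.absNorm (Ideal.span {((2 : ℕ) : 𝓞 K3)}) = 4 := by
  have h := absNorm_span_natCast 2
  have e : (((2 : ℕ) : ℤ) : 𝓞 K3) = ((2 : ℕ) : 𝓞 K3) := by push_cast; rfl
  rw [e] at h
  simpa using h

/-- **No ideal of `ℤ[ω]` has norm `2`** (`2` is inert: `(2)` is a prime of norm `4`). [cite: IrelandRosen1990, Prop. 9.1.4] -/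
theorem absNorm_ne_two (I : Ideal (𝓞 K3)) : Ideal.absNorm I ≠ 2 := by
  intro hI
  have hprime : I.IsPrime := Ideal.isPrime_of_irreducible_absNorm (by rw [hI]; exact Nat.prime_two)
  have h2mem : ((2 : ℕ) : 𝓞 K3) ∈ I := by
    have h := Ideal.absNorm_mem I
    rw [hI] at h
    exact_mod_cast h
  have hle : Ideal.span {((2 : ℕ) : 𝓞 K3)} ≤ I := (Ideal.span_singleton_le_iff_mem _).mpr h2mem
  have h20 : ((2 : ℕ) : 𝓞 K3) ≠ 0 := by exact_mod_cast (two_ne_zero : (2 : 𝓞 K3) ≠ 0)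
  have hP : (Ideal.span {((2 : ℕ) : 𝓞 K3)}).IsPrime := (Ideal.span_singleton_prime h20).mpr K3.prime_natCast_two
  have hM : (Ideal.span {((2 : ℕ) : 𝓞 K3)}).IsMaximal := hP.isMaximal (by rw [Ne, Ideal.span_singleton_eq_bot]; exact h20)
  have heq : Ideal.span {((2 : ℕ) : 𝓞 K3)} = I := hM.eq_of_le hprime.ne_top hle
  have h4 : Ideal.absNorm I = 4 := by rw [← heq, absNorm_span_two]
  omega

/-- The set of ideals of `ℤ[ω]` of norm `2` is empty. [cite: IrelandRosen1990, Prop. 9.1.4] -/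
theorem idealsOfNorm_K3_two : idealsOfNorm K3 2 = ∅ :=
  Finset.eq_empty_of_forall_notMem fun I hI ↦ absNorm_ne_two I (mem_idealsOfNorm.mp hI)

/-- **`a₂(27a3) = 0`** (`y² + y = x³`; the Hecke sum over ideals of norm `2` is empty). UNCONDITIONAL. [cite: IrelandRosen1990, Ch. 18 §7] -/
theorem lFunction_twentySevenA3_two : (⟨0, 0, 1, 0, 0⟩ : WeierstrassCurve ℚ).LFunction 2 = 0 := by
  have h := HeckeThetaTwentySeven.lFunction_twentySevenA3_eq_heckeSum 2
  rw [idealsOfNorm_K3_two, Finset.sum_empty] at h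
  exact_mod_cast h

/-- **`a₂(η(3τ)²η(9τ)²) = 0`** (the expansion is `q − 2q⁴ − q⁷ + ⋯`). UNCONDITIONAL. [cite: Koehler2011, §1] -/
theorem cuspCoeff_etaProductTwentySeven_two : cuspCoeff cuspFormEtaProductTwentySeven 2 = 0 := by
  rw [HeckeThetaTwentySeven.cuspCoeff_etaProductTwentySeven_eq_lFunction_twentySevenA3, lFunction_twentySevenA3_two, Int.cast_zero]

/-- **`a₂(W) = 0` for EVERY curve `W` carrying an `X₀(27)`-datum** (its newform is `η(3τ)²η(9τ)²`, p3's `f_eq_etaProductTwentySeven`). UNCONDITIONAL.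
[cite: CremonaAlgorithms1997, Table 3 (N = 27)] -/
theorem lFunction_two_eq_zero_of_datum_twentySeven {W : WeierstrassCurve ℚ} (D : ModularParametrizationData W 27) : W.LFunction 2 = 0 := by
  have h := D.isNewformOf.2 2
  rw [NonVacuityTwentySeven.f_eq_etaProductTwentySeven D, cuspCoeff_etaProductTwentySeven_two] at h
  exact_mod_cast h.symm

/-! ## §3 No half-index world at level `27` (fact-free) -/

/-- **`Λ₁(f) ⊄ 2Λ₀(f)` for every `X₀(27)`-datum, UNCONDITIONALLY**: the Eisenstein number at `ℓ = 2 ∤ 27` is `a₂ − 3 = −3`, odd (§1 + §2).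
[cite: LingOesterle1991, Thm. 6] -/
theorem not_halfIndex_twentySeven {W : WeierstrassCurve ℚ} (D : ModularParametrizationData W 27) :
    ¬ (∀ z ∈ periodLatticeGamma1 D.f, ∃ w ∈ periodLattice D.f, z = 2 * w) :=
  not_halfIndex_of_odd_eisenstein D Nat.prime_two (by decide) (by rw [lFunction_two_eq_zero_of_datum_twentySeven D]; exact ⟨-2, by norm_num⟩)

/-- Hence `2 ∤ c₀` for every lattice-optimal `X₀(27)`-datum with Stevens' inclusion `Λ₁(f) ⊆ Λ_W` — NO modularity (fact-free implication).
[cite: Stevens1989, §2] [cite: LingOesterle1991, Thm. 6] -/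
theorem not_two_dvd_maninConstant_twentySeven_of_gamma1Periods_le {W₀ : WeierstrassCurve ℚ} (D₀ : ModularParametrizationData W₀ 27)
    (hopt : ∀ z ∈ D₀.L.lattice, ∃ w ∈ periodLattice D₀.f, z = D₀.c * w) (hSI : ∀ z ∈ periodLatticeGamma1 D₀.f, z ∈ D₀.L.lattice) :
    ¬ (2 : ℤ) ∣ D₀.maninConstant := fun h2 ↦
  not_halfIndex_twentySeven D₀ (KummerValues.halfIndex_of_gamma1Periods_le_of_two_dvd D₀ hopt hSI h2)

/-! ## §4 Manin's conjecture for `X₀(27)` from CDT alone -/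

/-- **MANIN'S CONJECTURE FOR `X₀(27)` ⟸ THE UNBOUNDED DENOMINATORS THEOREM ALONE.**  For every globally minimal elliptic `W₀/ℚ` and every
lattice-optimal `X₀(27)`-datum `D₀` of `W₀`: `|c₀| = 1`.  Inputs: CDT (Stevens' inclusion), the fact-free `|c₀| ≤ 2 ∧ 3 ∤ c₀`, and §3 (no half-index at
`27`, from `a₂ = 0`) — no modularity, no Mazur / Abbes–Ullmo / Česnavičius, no Cremona table.  CONDITIONAL on CDT (printed, statement-only).
[cite: CalegariDimitrovTang2025, Thm. 1] [cite: Stevens1989, §2] [cite: LingOesterle1991, Thm. 6] [cite: CremonaAlgorithms1997, Table 1 (27a1)] -/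
theorem abs_maninConstant_eq_one_twentySeven_of_CDT (hCDT : CalegariDimitrovTang2025_unboundedDenominators)
    (W₀ : WeierstrassCurve ℚ) [W₀.IsElliptic] [W₀.IsGloballyMinimal] (D₀ : ModularParametrizationData W₀ 27)
    (hopt : ∀ z ∈ D₀.L.lattice, ∃ w ∈ periodLattice D₀.f, z = D₀.c * w) : |D₀.maninConstant| = 1 :=
  haveI : NeZero (27 : ℕ) := ⟨by decide⟩
  abs_maninConstant_eq_one_of_CDT_of_odd_eisenstein hCDT D₀ hopt Nat.prime_two (by decide)
    (by rw [lFunction_two_eq_zero_of_datum_twentySeven D₀]; exact ⟨-2, by norm_num⟩)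

/-- **… on an INHABITED domain: under CDT alone there IS a lattice-optimal `X₀(27)`-datum of a globally minimal curve in the class `27a`, and it has
`|c₀| = 1`** (existence = p3's and an's fact-free `HeckeThetaTwentySeven.exists_latticeOptimalDatum_twentySeven`).  CONDITIONAL on CDT only.
[cite: CalegariDimitrovTang2025, Thm. 1] [cite: Hecke1926Modulfunktionen] -/
theorem exists_datum_twentySeven_abs_maninConstant_eq_one_of_CDT (hCDT : CalegariDimitrovTang2025_unboundedDenominators) :
    ∃ (W₀ : WeierstrassCurve ℚ) (_ : W₀.IsElliptic) (_ : W₀.IsGloballyMinimal) (D₀ : ModularParametrizationData W₀ 27),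
      (⟨0, 0, 1, 0, 0⟩ : WeierstrassCurve ℚ).IsIsogenous W₀ ∧ (∀ z ∈ D₀.L.lattice, ∃ w ∈ periodLattice D₀.f, z = D₀.c * w) ∧ |D₀.maninConstant| = 1 := by
  obtain ⟨W₀, hE₀, hM₀, D₀, -, hiso, hopt⟩ := HeckeThetaTwentySeven.exists_latticeOptimalDatum_twentySeven
  haveI := hE₀; haveI := hM₀
  exact ⟨W₀, hE₀, hM₀, D₀, hiso, hopt, abs_maninConstant_eq_one_twentySeven_of_CDT hCDT W₀ D₀ hopt⟩

/-- **C2's, C3's and the rung's conclusion shapes at `27`, ⟸ CDT alone**: `2 ∤ c₀`, `3 ∤ c₀`, `|c₀| = 1` for every lattice-optimal `X₀(27)`-datum of a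
globally minimal curve.  CONDITIONAL on CDT only. [cite: CalegariDimitrovTang2025, Thm. 1] [cite: Stevens1989, §2] -/
theorem maninConstant_twentySeven_of_CDT (hCDT : CalegariDimitrovTang2025_unboundedDenominators)
    (W₀ : WeierstrassCurve ℚ) [W₀.IsElliptic] [W₀.IsGloballyMinimal] (D₀ : ModularParametrizationData W₀ 27)
    (hopt : ∀ z ∈ D₀.L.lattice, ∃ w ∈ periodLattice D₀.f, z = D₀.c * w) :
    ¬ (2 : ℤ) ∣ D₀.maninConstant ∧ ¬ (3 : ℤ) ∣ D₀.maninConstant ∧ |D₀.maninConstant| = 1 :=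
  haveI : NeZero (27 : ℕ) := ⟨by decide⟩
  ⟨not_two_dvd_maninConstant_twentySeven_of_gamma1Periods_le D₀ hopt (CDivisionInt.periodLatticeGamma1_le_neron_of_CDTInt hCDT D₀),
    NonVacuityTwentySeven.not_three_dvd_maninConstant_twentySeven_of_CDT hCDT W₀ D₀ hopt,
    abs_maninConstant_eq_one_twentySeven_of_CDT hCDT W₀ D₀ hopt⟩

/-! ## §5 (append, p3 g22) The parity lever makes the Shimura kernel CYCLIC, fact-free -/

/-- **An odd Eisenstein number makes `Λ₀(f)/Λ₁(f)` cyclic, UNCONDITIONALLY** (the Derickx–Orlić cyclicity question for the newform of an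
`X₀(N)`-datum, in the case where some prime `ℓ ∤ N` has `a_ℓ(W) − ℓ − 1` odd): `Λ₀(f) = ℤ·z₀ + Λ₁(f)` for some period `z₀`.  The cell had
cyclicity ⟸ modularity for every datum (`StevensGalois.shimuraKernelCyclic_of_modularity`); here §1 (no half-index) feeds p2 g24's
unconditional `ExistsMinimalOptimalDatum.shimuraKernelCyclic_body_of_notHalfIndex` (odd part = p3's fact-free conjugation obstruction).
[cite: LingOesterle1991, Thm. 6] [cite: Stevens1989, §2] -/
theorem shimuraKernelCyclic_of_odd_eisenstein {W : WeierstrassCurve ℚ} {N : ℕ} [NeZero N] (D : ModularParametrizationData W N)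
    {ℓ : ℕ} (hℓ : ℓ.Prime) (hℓN : ¬ ℓ ∣ N) (hodd : Odd (W.LFunction ℓ - ℓ - 1)) :
    ∃ z₀ ∈ periodLattice D.f, ∀ z ∈ periodLattice D.f, ∃ (k : ℤ) (w : ℂ), w ∈ periodLatticeGamma1 D.f ∧ z = (k : ℂ) * z₀ + w :=
  ExistsMinimalOptimalDatum.shimuraKernelCyclic_body_of_notHalfIndex W D (not_halfIndex_of_odd_eisenstein D hℓ hℓN hodd)

/-- **At level `27` the Shimura kernel `Λ₀(f)/Λ₁(f)` of every `X₀(27)`-datum is cyclic, UNCONDITIONALLY** (`ℓ = 2`, `a₂ = 0`); with Ling–Oesterlé's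
`(a₂ − 3)Λ₀ ⊆ Λ₁`, i.e. `3Λ₀ ⊆ Λ₁`, it is `0` or `ℤ/3`. [cite: LingOesterle1991, Thm. 6] -/
theorem shimuraKernelCyclic_twentySeven {W : WeierstrassCurve ℚ} (D : ModularParametrizationData W 27) :
    ∃ z₀ ∈ periodLattice D.f, ∀ z ∈ periodLattice D.f, ∃ (k : ℤ) (w : ℂ), w ∈ periodLatticeGamma1 D.f ∧ z = (k : ℂ) * z₀ + w :=
  ExistsMinimalOptimalDatum.shimuraKernelCyclic_body_of_notHalfIndex W D (not_halfIndex_twentySeven D)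

/-- **`3Λ₀(f) ⊆ Λ₁(f)` for every `X₀(27)`-datum, UNCONDITIONALLY** (Ling–Oesterlé at `ℓ = 2 ∤ 27` with `a₂ = 0`: the Eisenstein number is `−3`).
[cite: LingOesterle1991, Thm. 6] -/
theorem three_mul_mem_periodLatticeGamma1_twentySeven {W : WeierstrassCurve ℚ} (D : ModularParametrizationData W 27)
    {z : ℂ} (hz : z ∈ periodLattice D.f) : (3 : ℂ) * z ∈ periodLatticeGamma1 D.f := by
  haveI : NeZero (2 : ℕ) := ⟨two_ne_zero⟩
  have h := sub_sub_mul_mem_periodLatticeGamma1_of_isNewform0 D.f D.isNewformOf.1 Nat.prime_two (by decide) hz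
  rw [D.isNewformOf.2 2, lFunction_two_eq_zero_of_datum_twentySeven D] at h
  have e : ((((0 : ℤ) : ℂ)) - ((2 : ℕ) : ℂ) - 1) * z = -((3 : ℂ) * z) := by push_cast; ring
  rw [e] at h
  simpa using (periodLatticeGamma1 D.f).neg_mem h

end Summit.BirchSwinnertonDyer.BirchSwinnertonDyer.Theorems.ManinLocalTwoThree.ManinConstantTwentySeven

end
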